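import Summits.Ventures.PercRepro.C025ProfileGenCapCA
import Summits.Ventures.PercRepro.C025ProfileGenGeom

/-!
# The general certificate: (Cap)(c) — a four-point rank-3 set with a collinear triple pays at most 3, in every rank
(night-3 g8)

NIGHT3-G8-GENERAL-CERTIFICATE.md §3(c): `S = T₀ ∪ {u}`, `r := ρ(E∖S)`, `j₀ := j(T₀) = min(2, |L| − 3)`; by the counting
lemma the total is at most `c₀ + 3c₁ + 3c₂` with
* `r ≤ 1`: `(0, 1/2, 1/2)`; `r = 2`: `j₀ = 0 ↦ (1, 1/3, 1/3)`, `j₀ = 1 ↦ (3/2, 1/3, 0)` (`j₀ = 2` forces `r ≥ 3`);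
* `r ≥ 3`: `j₀ = 0 ↦ (1, 1/4, 1/4)`; `j₀ = 1 ↦ ((r+1)/r, 1/6, 1/6)`; `j₀ = 2 ↦ ((r+1)/(r−1), 1/(2r), 1/(3(r−1)))`, whose
  total `(r+2)/(r−1) + 3/(2r) ≤ 3` exactly when `(4r − 1)(r − 3) ≥ 0`, tight at `r = 3`.
-/

open scoped Matroid

namespace PercRepro

open Set Finset ThmH

section GenCapC

variable {α : Type} [DecidableEq α] {M : Matroid α} [M.Finite]

/-- Arithmetic: `(r+1)/(r−1) + 3·(1/(2r)) + 3·(1/(3(r−1))) ≤ 3` for `r ≥ 3`. -/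
theorem capc_total_le_three {r : ℚ} (hr : 3 ≤ r) :
    (r + 1) / (r - 1) + 3 * (1 / (2 * r)) + 3 * (1 / (3 * (r - 1))) ≤ 3 := by
  have h1 : (0 : ℚ) < r - 1 := by linarith
  have h2 : (0 : ℚ) < r := by linarith
  have e1 : (r + 1) / (r - 1) + 3 * (1 / (2 * r)) + 3 * (1 / (3 * (r - 1))) =
      (2 * r * (r + 1) + 3 * (r - 1) + 2 * r) / (2 * r * (r - 1)) := by
    field_simp
  rw [e1]
  have hden : (0 : ℚ) < 2 * r * (r - 1) := by positivity
  rw [div_le_iff₀ hden]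
  nlinarith

/-- A pair through `u` inside `insert u T₀` is `{x, u}` with `x ∈ T₀`. -/
theorem exists_eq_pair_u {T₀ B : Finset α} {u : α} (hB : B ⊆ insert u T₀) (hB2 : B.card = 2)
    (huB : u ∈ B) : ∃ x ∈ T₀, B = {x, u} := by
  have hc : (B.erase u).card = 1 := by rw [Finset.card_erase_of_mem huB, hB2]
  obtain ⟨x, hx⟩ := Finset.card_eq_one.1 hc
  have hxB : x ∈ B.erase u := by rw [hx]; exact Finset.mem_singleton_self _
  rw [Finset.mem_erase] at hxB
  refine ⟨x, ?_, ?_⟩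
  · have := hB hxB.2
    rw [Finset.mem_insert] at this
    rcases this with h | h
    · exact absurd h hxB.1
    · exact h
  · rw [← Finset.insert_erase huB, hx, Finset.pair_comm]

/-- **(Cap)(c) in every rank `≥ 4`**: a four-point rank-`3` set containing a collinear triple pays at most `3`. -/
theorem cap_wgn_of_card_four_of_triple (hR : (4 : ℕ∞) ≤ M.eRank) (hsimple : ∀ T ⊆ M.E, T.encard ≤ 2 → M.Indep T)
    {S T₀ : Finset α} (hS : S ∈ Shadow.levelSet M 3) (hS4 : S.card = 4) (hT₀S : T₀ ⊆ S) (hT₀c : T₀.card = 3)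
    (hT₀2 : M.eRk (T₀ : Set α) = 2) :
    ∑ B ∈ (Profile.Rq M 2).filter (fun B => B ⊆ S), wgn M B S ≤ 3 := by
  classical
  have hSg : S ⊆ gr M := (Profile.mem_levelSet.1 hS).1
  have hS3 : M.eRk (S : Set α) = 3 := (Profile.mem_levelSet.1 hS).2
  have hT₀g : T₀ ⊆ gr M := hT₀S.trans hSg
  have hc : (S \ T₀).card = 1 := by rw [Finset.card_sdiff_of_subset hT₀S, hS4, hT₀c]
  obtain ⟨u, hu⟩ := Finset.card_eq_one.1 hc
  have huST : u ∈ S ∧ u ∉ T₀ := by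
    have : u ∈ S \ T₀ := by rw [hu]; exact Finset.mem_singleton_self u
    exact Finset.mem_sdiff.1 this
  have hSeq : S = insert u T₀ := by
    ext x
    rw [Finset.mem_insert]
    constructor
    · intro hx
      by_cases hxT : x ∈ T₀
      · exact Or.inr hxT
      · left
        have : x ∈ S \ T₀ := Finset.mem_sdiff.2 ⟨hx, hxT⟩
        rw [hu] at this
        exact Finset.mem_singleton.1 this
    · rintro (rfl | hx)
      · exact huST.1
      · exact hT₀S hx
  have huL : u ∉ clF M T₀ := notMem_clF_of_insert_eRk_three hT₀g hT₀2 (by rw [← hSeq]; exact hS3)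
  have hLS : ∀ z ∈ clF M T₀, z ∉ T₀ → z ∉ S := by
    intro z hz hzT hzS
    rw [hSeq, Finset.mem_insert] at hzS
    rcases hzS with rfl | h
    · exact huL hz
    · exact hzT h
  have hsub : S ⊆ insert u (clF M T₀) := by
    rw [hSeq]; exact Finset.insert_subset_insert _ (subset_clF_self hT₀g)
  have hpairs : ∀ B ⊆ S, B.card = 2 → (S \ B).card = 2 := by
    intro B hB h2; rw [Finset.card_sdiff_of_subset hB, hS4, h2]
  have hT₀3 : 3 ≤ T₀.card := by omega
  have hcardT : (clF M T₀ \ T₀).card = (clF M T₀).card - T₀.card :=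
    Finset.card_sdiff_of_subset (subset_clF_self hT₀g)
  have hj₀ : jB M T₀ = min 2 ((clF M T₀).card - 3) := by unfold jB; rw [hT₀c]
  -- the j of an inner pair is min 2 (|L| − 2)
  have hinner : ∀ B ⊆ T₀, B.card = 2 → jB M B = min 2 ((clF M T₀).card - 2) := by
    intro B hB h2
    obtain ⟨x, y, hxy, rfl⟩ := Finset.card_eq_two.1 h2
    exact jB_pair_eq_of_subset_line hsimple hT₀g hT₀2 hxy (hB (Finset.mem_insert_self _ _))
      (hB (Finset.mem_insert_of_mem (Finset.mem_singleton_self _)))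
  -- a u-pair has S ∖ B ⊆ L
  have husub : ∀ B ⊆ S, B.card = 2 → u ∈ B → S \ B ⊆ clF M T₀ := by
    intro B hB h2 huB x hx
    rw [Finset.mem_sdiff] at hx
    have := hx.1
    rw [hSeq, Finset.mem_insert] at this
    rcases this with rfl | h
    · exact absurd huB hx.2
    · exact subset_clF_self hT₀g h
  have hbT := wgn_le_of_sdiff_singleton_three_le_card (M := M) hu hT₀3
  have hkT : 3 ≤ (clF M T₀).card := by
    have := Finset.card_le_card (subset_clF_self hT₀g); omega
  rcases Nat.lt_or_ge (crk M S) 2 with hr1 | hr2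
  · -- r ≤ 1
    have := cap_sum_le_of_bounds_g hsimple hS hS4 hT₀S hT₀c hT₀2 huST.1 huST.2 (c₀ := 0) (c₁ := 1 / 2) (c₂ := 1 / 2)
      (le_of_eq (hbT.1 (by omega)))
      (fun B hB h2 => wgn_le_half_of_sdiff_card_two (hpairs B (hB.trans hT₀S) h2) h2)
      (fun B hB h2 _ => wgn_le_half_of_sdiff_card_two (hpairs B hB h2) h2)
    linarith
  rcases Nat.lt_or_ge (crk M S) 3 with hr2' | hr3
  · -- r = 2
    have hr : crk M S = 2 := by omega
    have hj1 : jB M T₀ ≤ 1 := by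
      by_contra h
      push Not at h
      have hT2 : 2 ≤ (clF M T₀ \ T₀).card := by rw [hj₀] at h; omega
      obtain ⟨U, hUT, hUc⟩ := Finset.exists_subset_card_eq hT2
      obtain ⟨z, z', hzz', hU⟩ := Finset.card_eq_two.1 hUc
      have hz : z ∈ clF M T₀ \ T₀ := hUT (by rw [hU]; exact Finset.mem_insert_self _ _)
      have hz' : z' ∈ clF M T₀ \ T₀ := hUT (by rw [hU]; exact Finset.mem_insert_of_mem (Finset.mem_singleton_self _))
      have := three_le_crk_of_two_mem_clF_notMem' hR hsimple hT₀2 hsub hzz' (Finset.mem_sdiff.1 hz).1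
        (Finset.mem_sdiff.1 hz').1 (hLS z (Finset.mem_sdiff.1 hz).1 (Finset.mem_sdiff.1 hz).2)
        (hLS z' (Finset.mem_sdiff.1 hz').1 (Finset.mem_sdiff.1 hz').2)
      omega
    rcases Nat.lt_or_ge (jB M T₀) 1 with hj0 | hj1'
    · have hj : jB M T₀ = 0 := by omega
      have := cap_sum_le_of_bounds_g hsimple hS hS4 hT₀S hT₀c hT₀2 huST.1 huST.2 (c₀ := 1) (c₁ := 1 / 3) (c₂ := 1 / 3)
        (hbT.2.1 hj)
        (fun B hB h2 => wgn_le_third_of_sdiff_card_two_of_crk_eq_two (hpairs B (hB.trans hT₀S) h2) h2 hr)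
        (fun B hB h2 _ => wgn_le_third_of_sdiff_card_two_of_crk_eq_two (hpairs B hB h2) h2 hr)
      linarith
    · have hj : jB M T₀ = 1 := by omega
      have hT1 : 1 ≤ (clF M T₀ \ T₀).card := by rw [hj₀] at hj; omega
      obtain ⟨v, hv⟩ := Finset.card_pos.1 hT1
      have hvL : v ∈ clF M T₀ := (Finset.mem_sdiff.1 hv).1
      have hvS : v ∉ S := hLS v hvL (Finset.mem_sdiff.1 hv).2
      have hu0 : ∀ B ⊆ S, B.card = 2 → u ∈ B → wgn M B S ≤ 0 := by
        intro B hB h2 huB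
        apply le_of_eq
        have hp3 := crk_le_crk_add_one_of_sdiff_subset_clF hsimple hT₀2 hvL hvS (husub B hB h2 huB)
        exact wgn_eq_zero_of_sdiff_card_two_of_crk_eq_two_of_le_three (hpairs B hB h2) h2 hr (by omega)
      have hT32 : wgn M T₀ S ≤ 3 / 2 := by
        have := hbT.2.2.1 hj (by omega)
        rw [hr] at this
        norm_num at this
        exact this
      have := cap_sum_le_of_bounds_g hsimple hS hS4 hT₀S hT₀c hT₀2 huST.1 huST.2 (c₀ := 3 / 2) (c₁ := 1 / 3) (c₂ := 0)
        hT32 (fun B hB h2 => wgn_le_third_of_sdiff_card_two_of_crk_eq_two (hpairs B (hB.trans hT₀S) h2) h2 hr) hu0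
      linarith
  · -- r ≥ 3
    have hrq : (3 : ℚ) ≤ (crk M S : ℚ) := by exact_mod_cast hr3
    rcases Nat.lt_or_ge (jB M T₀) 1 with hj0 | hj1
    · -- j₀ = 0: the triple ≤ 1, every pair ≤ 1/4
      have hj : jB M T₀ = 0 := by omega
      have := cap_sum_le_of_bounds_g hsimple hS hS4 hT₀S hT₀c hT₀2 huST.1 huST.2 (c₀ := 1) (c₁ := 1 / 4) (c₂ := 1 / 4)
        (hbT.2.1 hj)
        (fun B hB h2 => wgn_le_quarter_of_sdiff_card_two_of_three_le_crk (hpairs B (hB.trans hT₀S) h2) h2 hr3)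
        (fun B hB h2 _ => wgn_le_quarter_of_sdiff_card_two_of_three_le_crk (hpairs B hB h2) h2 hr3)
      linarith
    rcases Nat.lt_or_ge (jB M T₀) 2 with hj1' | hj2
    · -- j₀ = 1: the triple ≤ (r+1)/r, inner pairs (j = 2) ≤ 1/6, u-pairs (p ≤ r + 1) ≤ 1/6
      have hj : jB M T₀ = 1 := by omega
      have hk : (clF M T₀).card = 4 := by rw [hj₀] at hj; omega
      have hT1 : 1 ≤ (clF M T₀ \ T₀).card := by omega
      obtain ⟨v, hv⟩ := Finset.card_pos.1 hT1
      have hvL : v ∈ clF M T₀ := (Finset.mem_sdiff.1 hv).1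
      have hvS : v ∉ S := hLS v hvL (Finset.mem_sdiff.1 hv).2
      have := cap_sum_le_of_bounds_g hsimple hS hS4 hT₀S hT₀c hT₀2 huST.1 huST.2
        (c₀ := ((crk M S : ℚ) + 1) / (crk M S : ℚ)) (c₁ := 1 / 6) (c₂ := 1 / 6)
        (hbT.2.2.1 hj (by omega))
        (fun B hB h2 => wgn_le_sixth_of_sdiff_card_two_of_jB_two (hpairs B (hB.trans hT₀S) h2) h2
          (by rw [hinner B hB h2, hk]; decide) hr3)
        (fun B hB h2 huB => wgn_le_sixth_of_sdiff_card_two_of_crk_le (hpairs B hB h2) h2 hr3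
          (crk_le_crk_add_one_of_sdiff_subset_clF hsimple hT₀2 hvL hvS (husub B hB h2 huB)))
      have hc₀ : ((crk M S : ℚ) + 1) / (crk M S : ℚ) ≤ 4 / 3 := by
        rw [div_le_div_iff₀ (by linarith) (by norm_num)]; linarith
      linarith
    · -- j₀ = 2: L ⊆ cl(E∖S); the triple ≤ (r+1)/(r−1), inner pairs ≤ 1/(2r), u-pairs ≤ 1/(3(r−1))
      have hj : jB M T₀ = 2 := by
        have : jB M T₀ ≤ 2 := by unfold jB; exact min_le_left _ _
        omega
      have hT2 : 2 ≤ (clF M T₀ \ T₀).card := by rw [hj₀] at hj; omega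
      obtain ⟨U, hUT, hUc⟩ := Finset.exists_subset_card_eq hT2
      obtain ⟨z, z', hzz', hU⟩ := Finset.card_eq_two.1 hUc
      have hz : z ∈ clF M T₀ \ T₀ := hUT (by rw [hU]; exact Finset.mem_insert_self _ _)
      have hz' : z' ∈ clF M T₀ \ T₀ := hUT (by rw [hU]; exact Finset.mem_insert_of_mem (Finset.mem_singleton_self _))
      have hzS : z ∉ S := hLS z (Finset.mem_sdiff.1 hz).1 (Finset.mem_sdiff.1 hz).2
      have hz'S : z' ∉ S := hLS z' (Finset.mem_sdiff.1 hz').1 (Finset.mem_sdiff.1 hz').2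
      have hline : ((clF M T₀ : Finset α) : Set α) ⊆ M.closure ((gr M \ S : Finset α) : Set α) :=
        clF_subset_closure_of_two_mem hsimple hT₀2 hzz' (Finset.mem_sdiff.1 hz).1 (Finset.mem_sdiff.1 hz').1
          (by rw [Finset.mem_coe, Finset.mem_sdiff]; exact ⟨clF_subset_gr T₀ (Finset.mem_sdiff.1 hz).1, hzS⟩)
          (by rw [Finset.mem_coe, Finset.mem_sdiff]; exact ⟨clF_subset_gr T₀ (Finset.mem_sdiff.1 hz').1, hz'S⟩)
      have := cap_sum_le_of_bounds_g hsimple hS hS4 hT₀S hT₀c hT₀2 huST.1 huST.2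
        (c₀ := ((crk M S : ℚ) + 1) / ((crk M S : ℚ) - 1)) (c₁ := 1 / (2 * (crk M S : ℚ)))
        (c₂ := 1 / (3 * ((crk M S : ℚ) - 1)))
        (hbT.2.2.2 hj hr3)
        (fun B hB h2 => by
          obtain ⟨x, y, hxy, rfl⟩ := Finset.card_eq_two.1 h2
          exact wgn_le_inv_two_r_of_sdiff_card_two (hpairs _ (hB.trans hT₀S) h2) h2 hr3
            (crk_pair_inner_le_of_line_subset hSeq hT₀g hline))
        (fun B hB h2 huB => by
          obtain ⟨x, hxT, rfl⟩ := exists_eq_pair_u (by rw [← hSeq]; exact hB) h2 huB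
          exact wgn_le_inv_three_of_sdiff_card_two_of_crk_eq (hpairs _ hB h2) h2 hr3
            (crk_pair_u_eq_of_line_subset hSeq hT₀g hline hxT))
      have hkey := capc_total_le_three hrq
      linarith

end GenCapC

end PercRepro
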